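import Mathlib
import HarnessLib
import Summits.HubbardSuperconductivity.HubbardSuperconductivity.Theorems.KLProgrammeKLRegimeEngineTowerBlockIncrWtPowAtKitSubTad
import Summits.HubbardSuperconductivity.HubbardSuperconductivity.Theorems.KLProgrammeKLRegimeEngineTowerPartialIncrWtPowAtSubTadpole

/-!
# Route `KLProgramme` — crux K3 ENGINE (stmt-HubbardSuperconductivity-20437 `KLRegimeEngineV17F2`), stub (b) / E1 interface (E2) in-tower route, located item
# «(E2)-ROUTE-TADPOLE», JOIN step (G4) «partial block»: THE SHARP KIT FORM OF THE TADPOLE-FREE DEGREE-`Dw` Hstep ON A PARTIAL INCREMENT `𝒱_{J₂} − 𝒱_{dk}` (`dk ≤ J₂`) —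
# first order = `towerFO` on the block's measured array with the input degrees `≤ q+2` ZEROED; per pin, any output family; measured-array and units forms
# (the «F4 pattern on a partial block»: twin of …TowerBlockIncrWtPowAtKitSubTad §2–§4 with the slice `(Λ_{J₂}, Λ_{dk}]`; interface memo
#  HOME/hubbard-kl-k3c3-p2/g20/E2-TOWER-SIDE-INTERFACE.md §2(d)/§5; k3c2-p3 g19 E2-CELL-READER.md §9 (G4); cell gate-hubbard-kl, seat hubbard-kl-k3c3-p2 g21)

The door `klWtPinnedSumPow_partialIncr_subTadpole_le` (…TowerPartialIncrWtPowAtSubTadpole) bounds the degree-`Dw` pinned sums of `(𝒱_{J₂} − 𝒱_{dk}) − Δ_Γ 𝒱_{dk}`,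
`Γ = C^K_{(Λ_{J₂}, Λ_{dk}]}`, by the graded bracket (orders `≥ 2`) plus the «minus-one-line» binomial sum over input degrees `m′ > q+2`.  Here, verbatim as for the full block
(…TowerBlockIncrWtPowAtKitSubTad): the pure real algebra `towerNumerics_doorBracketsSub_le_kit` turns the two door brackets into the kit with the first order on the TRUNCATED
array, the block's measured carrier `klTowerMeasWtPowAt … d k j Dw` (the partial block has the SAME input `𝒱_{dk}` at `F̃_{dk−1}` as the full block) serves the input sizes,
and the units identities `towerInputSizes_units[_trunc]` / `kitStep_abs_eq_units_mul_trunc` give the dimensionless form: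

* §1 **`klWtPinnedSumPow_partialIncr_subTadpole_le_kit_sharp (jr Dw)`** — binder version (abstract input sizes `B m′`, kit guard on `ε^{2m′}·B m′`);
* §2 **`klWtPinnedSumPow_partialIncr_subTadpole_le_kit_sharp_meas (j Dw)`** — input sizes served by `klTowerMeasWtPowAt`, kit guard on `ε·klTowerMeasWtPowAt … (2m′)`, PER PIN at
  any output family `J′ ≥ dk` (no supremum carrier is needed for a partial block: the (E2) reader and the closed form below read pins);
* §3 **`klWtPinnedSumPow_partialIncr_subTadpole_le_kit_units (j Dw)`** — §2 divided by any unit pair `(u, Kc)` (twin of `klTowerBornWtPowSubTadAt_le_kit_units`).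
Compositions of landed theorems and real algebra; slice/block constants (`κ`, degree-`Dw` weighted `α`, `cr/cc`) are HYPOTHESES (STOP RULE, pen g27 (R465)(E)(iii)/(R477): no
T3/T4 supplier row); nothing asserts (E2), (X).3, (b), any stub, K3, U₀, the window or superconductivity.
References: BGM 2006 §2.7 (2.70)–(2.71a), §2.8 (2.77), (2.81)–(2.84), (2.86)–(2.90), (2.93), §3 (3.2)–(3.8) [cite: BenfattoGiulianiMastropietro2006].
-/

noncomputable section

namespace Summit.HubbardSuperconductivity.HubbardSuperconductivity.Theorems.EngineV8

set_option linter.dupNamespace false -- summit = problem name (single-conjunct summit), D-0017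

open Real Finset Literature.MathematicalPhysics.QuantumLattice Literature.Probability.LatticeModels GrassmannAlgebra
open Literature.MathematicalPhysics.QuantumLattice.BandSectorCounting
open Summit.HubbardSuperconductivity.HubbardSuperconductivity.Theorems.KLProgrammeLegKernels
open Summit.HubbardSuperconductivity.HubbardSuperconductivity.Theorems.KLRegimeSplit
open Summit.HubbardSuperconductivity.HubbardSuperconductivity.Theorems.KLRegimeWick
open Summit.HubbardSuperconductivity.HubbardSuperconductivity.Theorems.TwoPointAssembly
open Summit.HubbardSuperconductivity.HubbardSuperconductivity.Theorems.TorusFourierL2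
open Summit.HubbardSuperconductivity.HubbardSuperconductivity.Theorems.DispersionFlow
open Literature.Probability.LatticeModels.BattleFederbush

/-! ## §1 The sharp kit form on a partial increment without its slice tadpole — binder version -/

variable {L M : ℕ} [NeZero L]

section Born

variable [NeZero M]

/-- §1 **THE DEGREE-`Dw` Hstep IN SHARP KIT FORM ON A PARTIAL INCREMENT WITHOUT ITS SLICE TADPOLE** `(𝒱_{J₂} − 𝒱_{dk}) − Δ_Γ 𝒱_{dk}`, `Γ = C^K_{(Λ_{J₂}, Λ_{dk}]}`
(`klWtPinnedSumPow` currency; twin of `klWtPinnedSumPow_klTowerIncr_subTadpole_le_kit_sharp` with the slice `(Λ_{J₂}, Λ_{dk}]`): the door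
`klWtPinnedSumPow_partialIncr_subTadpole_le` with its door guard served by the KIT guard on `N m′ := ε^{2m′}·B m′`; the first order is `towerFO D κ² N♭ (q+1)` on the TRUNCATED
sizes `N♭ m′ := if q+2 < m′ then N m′ else 0`.
[cite: BenfattoGiulianiMastropietro2006, (2.70)-(2.71a), (2.77), (2.81)-(2.84), (2.86)-(2.90), (3.2)-(3.8)] -/
theorem klWtPinnedSumPow_partialIncr_subTadpole_le_kit_sharp {β : ℝ} (hβ : 0 < β) (U μ : ℝ) (K : TrigPolyC4v) (jr Dw : ℕ) {d k J' J₂ : ℕ} (hd : 1 ≤ d)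
    (hk : 1 ≤ k) (hJ' : d * k ≤ J') (hJ₂ : d * k ≤ J₂)
    (hZ : hubbardEffPartitionFnCT L M β U μ 0 K (klScale klE0 (d * k)) ≠ 0)
    {κ : ℝ} (hκ : 0 < κ)
    (hGB : IsGramBoundedR ((sectorSubMatrix L M β (bgmFatMultiplier L M klE0 β (nambuXiCT L μ K) (d * k - 1))).transpose *
      hubbardCovSliceCT L M β μ 0 K (klScale klE0 J₂) (klScale klE0 (d * k)) *
        sectorSubMatrix L M β (bgmFatMultiplier L M klE0 β (nambuXiCT L μ K) (d * k - 1))) κ)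
    (B : ℕ → ℝ) (hB0 : ∀ m', 0 ≤ B m') (hB00 : B 0 = 0)
    (hB : ∀ (m' : ℕ) (t : Fin (2 * m')) (w : SpaceTimeIdx L M × SectorLeg (sectorCount (d * k - 1))),
      ∑ Y ∈ univ.filter (fun Y : Fin (2 * m') → SpaceTimeIdx L M × SectorLeg (sectorCount (d * k - 1)) => Y t = w),
        klScaleWtPow L M β jr Dw ((univ.image Y).image (latticeLegPos (2 * (2 * M)))) *
          ‖kernel ℂ (ExteriorAlgebra.map (Matrix.toLin' (sectorAnalysisMatrix L M β (klAnisoFamily L M β μ K klE0 (d * k - 1))))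
            (klTowerInput L M β U μ K d k)) (2 * m') Y‖ ≤ B m')
    {α : ℝ} (hα : 0 < α)
    (hrow : ∀ X, ∑ Y, ‖((sectorSubMatrix L M β (bgmFatMultiplier L M klE0 β (nambuXiCT L μ K) (d * k - 1))).transpose *
        hubbardCovSliceCT L M β μ 0 K (klScale klE0 J₂) (klScale klE0 (d * k)) *
          sectorSubMatrix L M β (bgmFatMultiplier L M klE0 β (nambuXiCT L μ K) (d * k - 1))) X Y‖ *
        klScaleWtPow L M β jr Dw {latticeLegPos (2 * (2 * M)) X, latticeLegPos (2 * (2 * M)) Y} ≤ α)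
    (hcol : ∀ Y, ∑ X, ‖((sectorSubMatrix L M β (bgmFatMultiplier L M klE0 β (nambuXiCT L μ K) (d * k - 1))).transpose *
        hubbardCovSliceCT L M β μ 0 K (klScale klE0 J₂) (klScale klE0 (d * k)) *
          sectorSubMatrix L M β (bgmFatMultiplier L M klE0 β (nambuXiCT L μ K) (d * k - 1))) X Y‖ *
        klScaleWtPow L M β jr Dw {latticeLegPos (2 * (2 * M)) X, latticeLegPos (2 * (2 * M)) Y} ≤ α)
    {ρ : ℝ} (hρ : 0 < ρ) {D : ℕ} (hD : Fintype.card (SpaceTimeIdx L M × SectorLeg (sectorCount (d * k - 1))) / 2 ≤ D)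
    (hguard : Real.exp 1 * α / κ ^ 2 *
      towerV D ((Real.exp 2 * (κ + ρ)) ^ 2) (fun m' => imagTimeWeight β M ^ (2 * m') * B m') < 1)
    {cr cc : ℝ} (hcr0 : 0 ≤ cr) (hcc0 : 0 ≤ cc)
    (hrow' : ∀ X'', ∑ X', ‖(sectorAnalysisMatrix L M β (klAnisoFamily L M β μ K klE0 J') *
        sectorSubMatrix L M β (bgmFatMultiplier L M klE0 β (nambuXiCT L μ K) (d * k - 1))) X'' X'‖ *
        klScaleWtPow L M β jr Dw {latticeLegPos (2 * (2 * M)) X'', latticeLegPos (2 * (2 * M)) X'} ≤ cr)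
    (hcol' : ∀ X', ∑ X'', ‖(sectorAnalysisMatrix L M β (klAnisoFamily L M β μ K klE0 J') *
        sectorSubMatrix L M β (bgmFatMultiplier L M klE0 β (nambuXiCT L μ K) (d * k - 1))) X'' X'‖ *
        klScaleWtPow L M β jr Dw {latticeLegPos (2 * (2 * M)) X'', latticeLegPos (2 * (2 * M)) X'} ≤ cc)
    {N₀ : ℕ} (hN₀ : 2 ≤ N₀) (q : ℕ) (i : Fin (2 * (q + 1))) (w'' : SpaceTimeIdx L M × SectorLeg (sectorCount J')) :
    klWtPinnedSumPow L M β μ K J' jr Dw (2 * (q + 1))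
        ((klEffectiveAction L M β U μ K klE0 J₂ - klTowerInput L M β U μ K d k) - grassmannLaplacian ℂ (hubbardCovSliceCT L M β μ 0 K (klScale klE0 J₂) (klScale klE0 (d * k))) (klTowerInput L M β U μ K d k)) i w'' ≤
      imagTimeWeight β M ^ (2 * q + 1) *
        (cr * cc ^ (2 * q + 1) *
          (towerFO D (κ ^ 2) (fun m' => if q + 2 < m' then imagTimeWeight β M ^ (2 * m') * B m' else 0) (q + 1) +
            ∑ n ∈ Icc 2 (N₀ - 1), Real.exp 1 * (Real.exp 1 * α / κ ^ 2) ^ (n - 1) * (ρ⁻¹ ^ 2) ^ (q + 1) *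
              towerS D ((Real.exp 2 * (κ + ρ)) ^ 2) (fun m' => imagTimeWeight β M ^ (2 * m') * B m') n (q + 1) +
            (ρ⁻¹ ^ 2) ^ (q + 1) * Real.exp 1 * towerV D ((Real.exp 2 * (κ + ρ)) ^ 2) (fun m' => imagTimeWeight β M ^ (2 * m') * B m') *
              (Real.exp 1 * α / κ ^ 2 * towerV D ((Real.exp 2 * (κ + ρ)) ^ 2) (fun m' => imagTimeWeight β M ^ (2 * m') * B m')) ^ (N₀ - 1) /
              (1 - Real.exp 1 * α / κ ^ 2 * towerV D ((Real.exp 2 * (κ + ρ)) ^ 2) (fun m' => imagTimeWeight β M ^ (2 * m') * B m')))) := by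
  set N : ℕ → ℝ := fun m' => imagTimeWeight β M ^ (2 * m') * B m' with hN
  have hε : 0 ≤ imagTimeWeight β M := imagTimeWeight_nonneg hβ.le M
  have hN0 : ∀ m, 0 ≤ N m := fun m => mul_nonneg (pow_nonneg hε _) (hB0 m)
  have hN00 : N 0 = 0 := by simp [hN, hB00]
  -- the door guard from the kit guard
  have hnV := normV_le_towerV (Γ := SpaceTimeIdx L M × SectorLeg (sectorCount (d * k - 1))) hκ.le hρ.le hN0 hN00 hD
  have hθ : Real.exp 1 * α * normV (SpaceTimeIdx L M × SectorLeg (sectorCount (d * k - 1))) κ ρ N / κ ^ 2 < 1 := by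
    have heq : Real.exp 1 * α * normV (SpaceTimeIdx L M × SectorLeg (sectorCount (d * k - 1))) κ ρ N / κ ^ 2 =
        Real.exp 1 * α / κ ^ 2 * normV (SpaceTimeIdx L M × SectorLeg (sectorCount (d * k - 1))) κ ρ N := by ring
    rw [heq]
    exact lt_of_le_of_lt (mul_le_mul_of_nonneg_left hnV (by positivity)) hguard
  have hborn := klWtPinnedSumPow_partialIncr_subTadpole_le (L := L) (M := M) hβ U μ K jr Dw hd hk hJ' hJ₂ hZ hκ hGB B hB0 hB hα hrow hcol hρ hθ hcc0
    hrow' hcol' hN₀ q i w''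
  have hkit := towerNumerics_doorBracketsSub_le_kit hκ hρ hα.le hcr0 hcc0 hN0 hN00 hD hN₀ q hguard
  exact hborn.trans (mul_le_mul_of_nonneg_left hkit (pow_nonneg hε _))

end Born

/-! ## §2 The sharp kit form with the input sizes served by the block's measured carrier `klTowerMeasWtPowAt` — per pin, any output family -/

section Carrier

variable [NeZero M]

/-- §2 **THE DEGREE-`Dw` Hstep IN SHARP KIT FORM ON A PARTIAL INCREMENT WITHOUT ITS SLICE TADPOLE, INPUT SIZES SERVED BY THE MEASURED CARRIER** (per pin, any output
family `J′ ≥ dk`; twin of `klTowerBornWtPowSubTadAt_le_kit_sharp` WITHOUT the supremum): binders of §1 without the input-size hypotheses — the block's measured degree-`Dw`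
array `klTowerMeasWtPowAt … d k j Dw` (✓ …TowerModelDefsWtPowAt; the partial block has the SAME input `𝒱_{dk}` as the full block) majorises them
(`towerInputMajorant_of_klTowerMeasWtPowAt`); kit guard on the sizes `N m′ := ε·klTowerMeasWtPowAt … (2m′)`; first order on `(if q+2 < m′ then N m′ else 0)`.
[cite: BenfattoGiulianiMastropietro2006, (2.70)-(2.71a), (2.77), (2.81)-(2.84), (2.86)-(2.90), (2.93), (3.2)-(3.8)] -/
theorem klWtPinnedSumPow_partialIncr_subTadpole_le_kit_sharp_meas {β : ℝ} (hβ : 0 < β) (U μ : ℝ) (K : TrigPolyC4v) (j Dw : ℕ) {d k J' J₂ : ℕ} (hd : 1 ≤ d)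
    (hk : 1 ≤ k) (hJ' : d * k ≤ J') (hJ₂ : d * k ≤ J₂)
    (hZ : hubbardEffPartitionFnCT L M β U μ 0 K (klScale klE0 (d * k)) ≠ 0)
    {κ : ℝ} (hκ : 0 < κ)
    (hGB : IsGramBoundedR ((sectorSubMatrix L M β (bgmFatMultiplier L M klE0 β (nambuXiCT L μ K) (d * k - 1))).transpose *
      hubbardCovSliceCT L M β μ 0 K (klScale klE0 J₂) (klScale klE0 (d * k)) *
        sectorSubMatrix L M β (bgmFatMultiplier L M klE0 β (nambuXiCT L μ K) (d * k - 1))) κ)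
    {α : ℝ} (hα : 0 < α)
    (hrow : ∀ X, ∑ Y, ‖((sectorSubMatrix L M β (bgmFatMultiplier L M klE0 β (nambuXiCT L μ K) (d * k - 1))).transpose *
        hubbardCovSliceCT L M β μ 0 K (klScale klE0 J₂) (klScale klE0 (d * k)) *
          sectorSubMatrix L M β (bgmFatMultiplier L M klE0 β (nambuXiCT L μ K) (d * k - 1))) X Y‖ *
        klScaleWtPow L M β j Dw {latticeLegPos (2 * (2 * M)) X, latticeLegPos (2 * (2 * M)) Y} ≤ α)
    (hcol : ∀ Y, ∑ X, ‖((sectorSubMatrix L M β (bgmFatMultiplier L M klE0 β (nambuXiCT L μ K) (d * k - 1))).transpose *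
        hubbardCovSliceCT L M β μ 0 K (klScale klE0 J₂) (klScale klE0 (d * k)) *
          sectorSubMatrix L M β (bgmFatMultiplier L M klE0 β (nambuXiCT L μ K) (d * k - 1))) X Y‖ *
        klScaleWtPow L M β j Dw {latticeLegPos (2 * (2 * M)) X, latticeLegPos (2 * (2 * M)) Y} ≤ α)
    {ρ : ℝ} (hρ : 0 < ρ) {D : ℕ} (hD : Fintype.card (SpaceTimeIdx L M × SectorLeg (sectorCount (d * k - 1))) / 2 ≤ D)
    (hguard : Real.exp 1 * α / κ ^ 2 *
      towerV D ((Real.exp 2 * (κ + ρ)) ^ 2) (fun m' => imagTimeWeight β M * klTowerMeasWtPowAt L M β U μ K d k j Dw (2 * m')) < 1)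
    {cr cc : ℝ} (hcr0 : 0 ≤ cr) (hcc0 : 0 ≤ cc)
    (hrow' : ∀ X'', ∑ X', ‖(sectorAnalysisMatrix L M β (klAnisoFamily L M β μ K klE0 J') *
        sectorSubMatrix L M β (bgmFatMultiplier L M klE0 β (nambuXiCT L μ K) (d * k - 1))) X'' X'‖ *
        klScaleWtPow L M β j Dw {latticeLegPos (2 * (2 * M)) X'', latticeLegPos (2 * (2 * M)) X'} ≤ cr)
    (hcol' : ∀ X', ∑ X'', ‖(sectorAnalysisMatrix L M β (klAnisoFamily L M β μ K klE0 J') *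
        sectorSubMatrix L M β (bgmFatMultiplier L M klE0 β (nambuXiCT L μ K) (d * k - 1))) X'' X'‖ *
        klScaleWtPow L M β j Dw {latticeLegPos (2 * (2 * M)) X'', latticeLegPos (2 * (2 * M)) X'} ≤ cc)
    {N₀ : ℕ} (hN₀ : 2 ≤ N₀) (q : ℕ) (i : Fin (2 * (q + 1))) (w'' : SpaceTimeIdx L M × SectorLeg (sectorCount J')) :
    klWtPinnedSumPow L M β μ K J' j Dw (2 * (q + 1))
        ((klEffectiveAction L M β U μ K klE0 J₂ - klTowerInput L M β U μ K d k) -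
          grassmannLaplacian ℂ (hubbardCovSliceCT L M β μ 0 K (klScale klE0 J₂) (klScale klE0 (d * k))) (klTowerInput L M β U μ K d k)) i w'' ≤
      imagTimeWeight β M ^ (2 * q + 1) *
        (cr * cc ^ (2 * q + 1) *
          (towerFO D (κ ^ 2) (fun m' => if q + 2 < m' then imagTimeWeight β M * klTowerMeasWtPowAt L M β U μ K d k j Dw (2 * m') else 0) (q + 1) +
            ∑ n ∈ Icc 2 (N₀ - 1), Real.exp 1 * (Real.exp 1 * α / κ ^ 2) ^ (n - 1) * (ρ⁻¹ ^ 2) ^ (q + 1) *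
              towerS D ((Real.exp 2 * (κ + ρ)) ^ 2) (fun m' => imagTimeWeight β M * klTowerMeasWtPowAt L M β U μ K d k j Dw (2 * m')) n (q + 1) +
            (ρ⁻¹ ^ 2) ^ (q + 1) * Real.exp 1 *
              towerV D ((Real.exp 2 * (κ + ρ)) ^ 2) (fun m' => imagTimeWeight β M * klTowerMeasWtPowAt L M β U μ K d k j Dw (2 * m')) *
              (Real.exp 1 * α / κ ^ 2 *
                towerV D ((Real.exp 2 * (κ + ρ)) ^ 2) (fun m' => imagTimeWeight β M * klTowerMeasWtPowAt L M β U μ K d k j Dw (2 * m'))) ^ (N₀ - 1) /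
              (1 - Real.exp 1 * α / κ ^ 2 *
                towerV D ((Real.exp 2 * (κ + ρ)) ^ 2) (fun m' => imagTimeWeight β M * klTowerMeasWtPowAt L M β U μ K d k j Dw (2 * m'))))) := by
  have hε := imagTimeWeight_pos_of_pos (M := M) hβ
  set B : ℕ → ℝ := fun m' => klTowerMeasWtPowAt L M β U μ K d k j Dw (2 * m') / imagTimeWeight β M ^ (2 * m' - 1) with hBdef
  have hB0 : ∀ m', 0 ≤ B m' := fun m' => div_nonneg (klTowerMeasWtPowAt_nonneg hβ.le U μ K d k j Dw _) (pow_nonneg hε.le _)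
  have hB00 : B 0 = 0 := by simp [hBdef, klTowerMeasWtPowAt_zero]
  have hB : ∀ (m' : ℕ) (t : Fin (2 * m')) (w : SpaceTimeIdx L M × SectorLeg (sectorCount (d * k - 1))),
      ∑ Y ∈ univ.filter (fun Y : Fin (2 * m') → SpaceTimeIdx L M × SectorLeg (sectorCount (d * k - 1)) => Y t = w),
        klScaleWtPow L M β j Dw ((univ.image Y).image (latticeLegPos (2 * (2 * M)))) *
          ‖kernel ℂ (ExteriorAlgebra.map (Matrix.toLin' (sectorAnalysisMatrix L M β (klAnisoFamily L M β μ K klE0 (d * k - 1))))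
            (klTowerInput L M β U μ K d k)) (2 * m') Y‖ ≤ B m' :=
    fun m' t w => towerInputMajorant_of_klTowerMeasWtPowAt hβ U μ K d k j Dw m' t w
  have hNeq := towerInputSizesPow_eq (L := L) (M := M) hβ U μ K d k j Dw
  have hNeq' := towerInputSizesPow_trunc_eq (L := L) (M := M) hβ U μ K d k j Dw q
  -- the kit guard in `B`-form
  have hguard' : Real.exp 1 * α / κ ^ 2 *
      towerV D ((Real.exp 2 * (κ + ρ)) ^ 2) (fun m' => imagTimeWeight β M ^ (2 * m') * B m') < 1 := by
    rw [hBdef]; rw [hNeq]; exact hguard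
  have h := klWtPinnedSumPow_partialIncr_subTadpole_le_kit_sharp (L := L) (M := M) hβ U μ K j Dw hd hk hJ' hJ₂ hZ hκ hGB B hB0 hB00 hB hα hrow hcol
    hρ hD hguard' hcr0 hcc0 hrow' hcol' hN₀ q i w''
  rw [hBdef] at h; rw [hNeq, hNeq'] at h
  exact h

/-! ## §3 The sharp kit form per pin, divided by units -/

/-- §3 **THE TADPOLE-FREE DEGREE-`Dw` Hstep ON A PARTIAL INCREMENT IN THE KIT's DIMENSIONLESS FORM, ANY UNITS `(u, Kc)`** (per pin, any output family `J′ ≥ dk`;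
twin of `klTowerBornWtPowSubTadAt_le_kit_units`): with `μ m := klTowerMeasWtPowAt … d k j Dw (2m)/(Kc·u^m)` and the truncated `μ♭ m := if q+2 < m then μ m else 0`,
`klWtPinnedSumPow … J′ j Dw (2(q+1)) ((𝒱_{J₂} − 𝒱_{dk}) − Δ_Γ 𝒱_{dk}) i w″ ≤ (ε·cr)·(ε·cc)^{2q+1}·(u^{q+1}·Kc)·[towerFO D (κ²u) μ♭ (q+1) + Σ e·Φ̂^{n−1}·ψ̂^{q+1}·towerS D (τu) μ n (q+1) +
ψ̂^{q+1}·e·V̂·(Φ̂V̂)^{N₀−1}/(1−Φ̂V̂)]`, `τ = (e²(κ+ρ))²`, `Φ̂ = (eα/κ²)·(ε·Kc)`, `ψ̂ = ρ⁻²/u`, `V̂ = towerV D (τu) μ`.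
[cite: BenfattoGiulianiMastropietro2006, (2.70)-(2.71a), §2.8 (2.83), (2.93), §3 (3.2)-(3.8)] -/
theorem klWtPinnedSumPow_partialIncr_subTadpole_le_kit_units {β : ℝ} (hβ : 0 < β) (U μ : ℝ) (K : TrigPolyC4v) (j Dw : ℕ) {d k J' J₂ : ℕ} (hd : 1 ≤ d)
    (hk : 1 ≤ k) (hJ' : d * k ≤ J') (hJ₂ : d * k ≤ J₂)
    (hZ : hubbardEffPartitionFnCT L M β U μ 0 K (klScale klE0 (d * k)) ≠ 0)
    {κ : ℝ} (hκ : 0 < κ)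
    (hGB : IsGramBoundedR ((sectorSubMatrix L M β (bgmFatMultiplier L M klE0 β (nambuXiCT L μ K) (d * k - 1))).transpose *
      hubbardCovSliceCT L M β μ 0 K (klScale klE0 J₂) (klScale klE0 (d * k)) *
        sectorSubMatrix L M β (bgmFatMultiplier L M klE0 β (nambuXiCT L μ K) (d * k - 1))) κ)
    {α : ℝ} (hα : 0 < α)
    (hrow : ∀ X, ∑ Y, ‖((sectorSubMatrix L M β (bgmFatMultiplier L M klE0 β (nambuXiCT L μ K) (d * k - 1))).transpose *
        hubbardCovSliceCT L M β μ 0 K (klScale klE0 J₂) (klScale klE0 (d * k)) *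
          sectorSubMatrix L M β (bgmFatMultiplier L M klE0 β (nambuXiCT L μ K) (d * k - 1))) X Y‖ *
        klScaleWtPow L M β j Dw {latticeLegPos (2 * (2 * M)) X, latticeLegPos (2 * (2 * M)) Y} ≤ α)
    (hcol : ∀ Y, ∑ X, ‖((sectorSubMatrix L M β (bgmFatMultiplier L M klE0 β (nambuXiCT L μ K) (d * k - 1))).transpose *
        hubbardCovSliceCT L M β μ 0 K (klScale klE0 J₂) (klScale klE0 (d * k)) *
          sectorSubMatrix L M β (bgmFatMultiplier L M klE0 β (nambuXiCT L μ K) (d * k - 1))) X Y‖ *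
        klScaleWtPow L M β j Dw {latticeLegPos (2 * (2 * M)) X, latticeLegPos (2 * (2 * M)) Y} ≤ α)
    {ρ : ℝ} (hρ : 0 < ρ) {D : ℕ} (hD : Fintype.card (SpaceTimeIdx L M × SectorLeg (sectorCount (d * k - 1))) / 2 ≤ D)
    (hguard : Real.exp 1 * α / κ ^ 2 *
      towerV D ((Real.exp 2 * (κ + ρ)) ^ 2) (fun m' => imagTimeWeight β M * klTowerMeasWtPowAt L M β U μ K d k j Dw (2 * m')) < 1)
    {cr cc : ℝ} (hcr0 : 0 ≤ cr) (hcc0 : 0 ≤ cc)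
    (hrow' : ∀ X'', ∑ X', ‖(sectorAnalysisMatrix L M β (klAnisoFamily L M β μ K klE0 J') *
        sectorSubMatrix L M β (bgmFatMultiplier L M klE0 β (nambuXiCT L μ K) (d * k - 1))) X'' X'‖ *
        klScaleWtPow L M β j Dw {latticeLegPos (2 * (2 * M)) X'', latticeLegPos (2 * (2 * M)) X'} ≤ cr)
    (hcol' : ∀ X', ∑ X'', ‖(sectorAnalysisMatrix L M β (klAnisoFamily L M β μ K klE0 J') *
        sectorSubMatrix L M β (bgmFatMultiplier L M klE0 β (nambuXiCT L μ K) (d * k - 1))) X'' X'‖ *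
        klScaleWtPow L M β j Dw {latticeLegPos (2 * (2 * M)) X'', latticeLegPos (2 * (2 * M)) X'} ≤ cc)
    {N₀ : ℕ} (hN₀ : 2 ≤ N₀) (q : ℕ) {u Kc : ℝ} (hu : 0 < u) (hKc : 0 < Kc)
    (i : Fin (2 * (q + 1))) (w'' : SpaceTimeIdx L M × SectorLeg (sectorCount J')) :
    klWtPinnedSumPow L M β μ K J' j Dw (2 * (q + 1))
        ((klEffectiveAction L M β U μ K klE0 J₂ - klTowerInput L M β U μ K d k) -
          grassmannLaplacian ℂ (hubbardCovSliceCT L M β μ 0 K (klScale klE0 J₂) (klScale klE0 (d * k))) (klTowerInput L M β U μ K d k)) i w'' ≤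
      (imagTimeWeight β M * cr) * (imagTimeWeight β M * cc) ^ (2 * q + 1) * (u ^ (q + 1) * Kc) *
        (towerFO D (κ ^ 2 * u) (fun m => if q + 2 < m then klTowerMeasWtPowAt L M β U μ K d k j Dw (2 * m) / (Kc * u ^ m) else 0) (q + 1) +
          ∑ n ∈ Icc 2 (N₀ - 1), Real.exp 1 * (Real.exp 1 * α / κ ^ 2 * (imagTimeWeight β M * Kc)) ^ (n - 1) * (ρ⁻¹ ^ 2 / u) ^ (q + 1) *
            towerS D ((Real.exp 2 * (κ + ρ)) ^ 2 * u) (fun m => klTowerMeasWtPowAt L M β U μ K d k j Dw (2 * m) / (Kc * u ^ m)) n (q + 1) +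
          (ρ⁻¹ ^ 2 / u) ^ (q + 1) * Real.exp 1 *
            towerV D ((Real.exp 2 * (κ + ρ)) ^ 2 * u) (fun m => klTowerMeasWtPowAt L M β U μ K d k j Dw (2 * m) / (Kc * u ^ m)) *
            (Real.exp 1 * α / κ ^ 2 * (imagTimeWeight β M * Kc) *
              towerV D ((Real.exp 2 * (κ + ρ)) ^ 2 * u) (fun m => klTowerMeasWtPowAt L M β U μ K d k j Dw (2 * m) / (Kc * u ^ m))) ^ (N₀ - 1) /
            (1 - Real.exp 1 * α / κ ^ 2 * (imagTimeWeight β M * Kc) *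
              towerV D ((Real.exp 2 * (κ + ρ)) ^ 2 * u) (fun m => klTowerMeasWtPowAt L M β U μ K d k j Dw (2 * m) / (Kc * u ^ m)))) := by
  have hε := imagTimeWeight_pos_of_pos (M := M) hβ
  have h := klWtPinnedSumPow_partialIncr_subTadpole_le_kit_sharp_meas (L := L) (M := M) hβ U μ K j Dw hd hk hJ' hJ₂ hZ hκ hGB hα hrow hcol hρ hD hguard hcr0 hcc0
    hrow' hcol' hN₀ q i w''
  have hN := towerInputSizes_units (ε := imagTimeWeight β M) hu.ne' hKc.ne' (fun m => klTowerMeasWtPowAt L M β U μ K d k j Dw m)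
  have hN' := towerInputSizes_units_trunc (ε := imagTimeWeight β M) hu.ne' hKc.ne' (fun m => klTowerMeasWtPowAt L M β U μ K d k j Dw m) q
  rw [hN, hN'] at h
  rw [kitStep_abs_eq_units_mul_trunc (mul_ne_zero hε.ne' hKc.ne') hu.ne'] at h
  refine h.trans (le_of_eq ?_)
  ring

end Carrier

end Summit.HubbardSuperconductivity.HubbardSuperconductivity.Theorems.EngineV8

end
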